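import Literature.Barriers.CriticalPhenomena.SAPWords
import Mathlib.Algebra.Order.BigOperators.Group.Finset
import Mathlib.Data.Int.Interval
import HarnessLib

/-!
# Stretching and contracting columns of step words (haruspicy, layer 3)

Companion of `SAPAnisotropicNotDFinite` / `SAPWords` (towards `Rechnitzer2006_thm1`). The
haruspicy proof of the rationality of the rows `H_n(x)` reduces every polygon to a minimal one
by deleting duplicate columns and recovers the whole class of a minimal polygon by re-inserting
columns (Rechnitzer 2006, §2.1: section deletion / duplication; here in the coarser form of
whole-column duplication, which suffices for Theorem 1). On step words `u : List (Fin 4)`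
(`SAPWords`) both operations are instances of ONE operation, `restretch τ x u` for a width
function `τ : ℤ → ℕ` on the gaps `g = [g, g+1]` between columns: every horizontal letter
crossing the gap `g` is replaced by `τ g` copies of itself (`τ g = 0` deletes, `τ g ≥ 2`
duplicates), vertical letters are kept; `x` is the column of the starting point. The columns are
relabelled by the piecewise-linear map `Phi τ` (`Phi τ 0 = 0`, `Phi τ (g+1) = Phi τ g + τ g`).

Main results (all [folklore]): `restretch_append`, the endpoint formula
`vtx_restretch_length_zero/one`, the composition law `restretch_restretch`
(`restretch σ ∘ restretch τ = restretch (comp τ σ)`), `restretch_congr` / `restretch_eq_self`,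
the counts `vcount_restretch`, `hcount_restretch`, injectivity `restretch_injective` (`τ ≥ 1`),
the vertex formula `vtx_restretch` and the block decomposition of indices `exists_block` /
`block_unique`, and the floor decomposition `Phi_block_inj` for `Phi`.

## References

* A. Rechnitzer, *Haruspicy 2*, J. Combin. Theory Ser. A 113 (2006), §2.1 (Definitions 2–4,
  Lemma 5). [Rechnitzer2006Haruspicy2]
-/

noncomputable section

open Finset Literature.Probability.LatticeModels Literature.Probability.Percolation
open scoped BigOperators

namespace Literature.Barriers.CriticalPhenomena

namespace Haruspicy

open Edwards2D

/-! ### The column relabelling `Φ_τ` -/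

/-- `Φ_τ(x)`: the new coordinate of column `x` when every gap `g` is given width `τ g`
(`Φ_τ(0) = 0`, `Φ_τ(g+1) = Φ_τ(g) + τ g`). [folklore] -/
def Phi (τ : ℤ → ℕ) (x : ℤ) : ℤ :=
  (∑ g ∈ Finset.Ico 0 x, (τ g : ℤ)) - ∑ g ∈ Finset.Ico x 0, (τ g : ℤ)

/-- `Φ_τ(0) = 0`. [folklore] -/
@[simp] theorem Phi_zero (τ : ℤ → ℕ) : Phi τ 0 = 0 := by
  simp [Phi]

/-- Splitting a gap sum at an intermediate column. [folklore] -/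
theorem sum_Ico_add_sum_Ico (τ : ℤ → ℕ) {a b c : ℤ} (hab : a ≤ b) (hbc : b ≤ c) :
    (∑ g ∈ Finset.Ico a b, (τ g : ℤ)) + ∑ g ∈ Finset.Ico b c, (τ g : ℤ) =
      ∑ g ∈ Finset.Ico a c, (τ g : ℤ) := by
  rw [← Finset.sum_union (Finset.Ico_disjoint_Ico_consecutive a b c),
    Finset.Ico_union_Ico_eq_Ico hab hbc]

/-- `Φ_τ(b) - Φ_τ(a)` is the total width of the gaps in `[a, b)`. [folklore] -/
theorem Phi_sub_Phi (τ : ℤ → ℕ) {a b : ℤ} (h : a ≤ b) :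
    Phi τ b - Phi τ a = ∑ g ∈ Finset.Ico a b, (τ g : ℤ) := by
  unfold Phi
  rcases le_total 0 a with ha | ha
  · rw [Finset.Ico_eq_empty_of_le ha, Finset.Ico_eq_empty_of_le (ha.trans h), Finset.sum_empty,
      ← sum_Ico_add_sum_Ico τ ha h]
    ring
  · rcases le_total b 0 with hb | hb
    · rw [Finset.Ico_eq_empty_of_le hb, Finset.Ico_eq_empty_of_le (h.trans hb), Finset.sum_empty,
        ← sum_Ico_add_sum_Ico τ h hb]
      ring
    · rw [Finset.Ico_eq_empty_of_le ha, Finset.Ico_eq_empty_of_le hb, Finset.sum_empty,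
        ← sum_Ico_add_sum_Ico τ ha hb]
      ring

/-- The defining recursion `Φ_τ(x+1) = Φ_τ(x) + τ x`. [folklore] -/
theorem Phi_succ (τ : ℤ → ℕ) (x : ℤ) : Phi τ (x + 1) = Phi τ x + τ x := by
  have h := Phi_sub_Phi τ (show x ≤ x + 1 by omega)
  have hI : Finset.Ico x (x + 1) = {x} := by
    ext g
    simp only [Finset.mem_Ico, Finset.mem_singleton]
    omega
  rw [hI, Finset.sum_singleton] at h
  linarith

/-- `Φ_τ` is monotone. [folklore] -/
theorem Phi_mono (τ : ℤ → ℕ) : Monotone (Phi τ) := fun a b h => by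
  have h1 := Phi_sub_Phi τ h
  have h0 : 0 ≤ ∑ g ∈ Finset.Ico a b, (τ g : ℤ) := Finset.sum_nonneg fun _ _ => by positivity
  linarith

/-- `Φ_τ(a) + τ a ≤ Φ_τ(b)` for `a < b`. [folklore] -/
theorem Phi_add_le_Phi (τ : ℤ → ℕ) {a b : ℤ} (h : a < b) : Phi τ a + τ a ≤ Phi τ b := by
  rw [← Phi_succ]
  exact Phi_mono τ (show a + 1 ≤ b by omega)

/-- `Φ_τ` is strictly increasing across a gap of positive width. [folklore] -/
theorem Phi_lt_Phi (τ : ℤ → ℕ) {a b : ℤ} (h : a < b) (h1 : 1 ≤ τ a) : Phi τ a < Phi τ b := by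
  have := Phi_add_le_Phi τ h
  have h1' : (1 : ℤ) ≤ τ a := by exact_mod_cast h1
  linarith

/-- `Φ_τ` is strictly monotone when all widths are positive. [folklore] -/
theorem Phi_strictMono (τ : ℤ → ℕ) (h : ∀ g, 1 ≤ τ g) : StrictMono (Phi τ) :=
  fun _ _ hab => Phi_lt_Phi τ hab (h _)

/-- **Floor decomposition**: a new column is `Φ_τ(g) + s` with `0 ≤ s < τ g` for at most one
pair `(g, s)`. [folklore] -/
theorem Phi_block_inj (τ : ℤ → ℕ) {g g' s s' : ℤ} (hs : 0 ≤ s) (hs' : s < τ g) (ht : 0 ≤ s')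
    (ht' : s' < τ g') (h : Phi τ g + s = Phi τ g' + s') : g = g' ∧ s = s' := by
  rcases lt_trichotomy g g' with hlt | rfl | hgt
  · have := Phi_add_le_Phi τ hlt
    omega
  · exact ⟨rfl, by omega⟩
  · have := Phi_add_le_Phi τ hgt
    omega

/-! ### The operation `restretch` -/

/-- The gap crossed by the horizontal letter `a` read at column `x`: `[x, x+1]` for `E`,
`[x-1, x]` for `W` (junk `x` for vertical letters). [folklore] -/
def gapOf (x : ℤ) (a : Fin 4) : ℤ := if a = 1 then x - 1 else x

/-- The multiplicity of the letter `a` read at column `x`: `τ` of its gap if horizontal, `1` if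
vertical. [folklore] -/
def mult (τ : ℤ → ℕ) (x : ℤ) (a : Fin 4) : ℕ := if a.val < 2 then τ (gapOf x a) else 1

/-- Multiplicity of `E`. [folklore] -/
@[simp] theorem mult_E (τ : ℤ → ℕ) (x : ℤ) : mult τ x 0 = τ x := by simp [mult, gapOf]
/-- Multiplicity of `W`. [folklore] -/
@[simp] theorem mult_W (τ : ℤ → ℕ) (x : ℤ) : mult τ x 1 = τ (x - 1) := by simp [mult, gapOf]
/-- Multiplicity of `N`. [folklore] -/
@[simp] theorem mult_N (τ : ℤ → ℕ) (x : ℤ) : mult τ x 2 = 1 := by simp [mult]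
/-- Multiplicity of `S`. [folklore] -/
@[simp] theorem mult_S (τ : ℤ → ℕ) (x : ℤ) : mult τ x 3 = 1 := by simp [mult]

/-- With unit widths every letter has multiplicity one. [folklore] -/
theorem mult_one (x : ℤ) (a : Fin 4) : mult (fun _ => 1) x a = 1 := by
  simp [mult]

/-- With positive widths every multiplicity is positive. [folklore] -/
theorem one_le_mult {τ : ℤ → ℕ} (h : ∀ g, 1 ≤ τ g) (x : ℤ) (a : Fin 4) : 1 ≤ mult τ x a := by
  unfold mult
  split_ifs
  · exact h _
  · exact le_rfl

/-- **Re-stretching** a step word read from column `x`: each horizontal letter crossing the gap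
`g` becomes `τ g` copies of itself, vertical letters are kept (`τ g = 0` deletes the column pair
across `g`, `τ g = 2` duplicates it). [cite: Rechnitzer2006Haruspicy2, §2.1, Definition 3] -/
def restretch (τ : ℤ → ℕ) : ℤ → List (Fin 4) → List (Fin 4)
  | _, [] => []
  | x, a :: u => List.replicate (mult τ x a) a ++ restretch τ (x + stepVec a 0) u

/-- `restretch` of the empty word. [folklore] -/
@[simp] theorem restretch_nil (τ : ℤ → ℕ) (x : ℤ) : restretch τ x [] = [] := rfl

/-- `restretch` of a word with a first letter. [folklore] -/
@[simp] theorem restretch_cons (τ : ℤ → ℕ) (x : ℤ) (a : Fin 4) (u : List (Fin 4)) :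
    restretch τ x (a :: u) = List.replicate (mult τ x a) a ++ restretch τ (x + stepVec a 0) u :=
  rfl

/-- Vertices of a word with a first letter. [folklore] -/
theorem vtx_cons_succ (a : Fin 4) (u : List (Fin 4)) (i : ℕ) :
    vtx (a :: u) (i + 1) = stepVec a + vtx u i := by
  simp [vtx]

/-- `restretch` of a concatenation: the second word is read from the column where the first
ends. [folklore] -/
theorem restretch_append (τ : ℤ → ℕ) (x : ℤ) (u v : List (Fin 4)) :
    restretch τ x (u ++ v) = restretch τ x u ++ restretch τ (x + vtx u u.length 0) v := by
  induction u generalizing x with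
  | nil => simp
  | cons a u ih =>
    simp only [List.cons_append, restretch_cons, ih, List.append_assoc, List.length_cons,
      vtx_cons_succ, Pi.add_apply, add_assoc]

/-- The steps of a constant word. [folklore] -/
theorem sum_replicate_stepVec (m : ℕ) (a : Fin 4) :
    ((List.replicate m a).map stepVec).sum = m • stepVec a := by
  simp [List.map_replicate, List.sum_replicate]

/-- Vertices of a constant word. [folklore] -/
theorem vtx_replicate (m : ℕ) (a : Fin 4) {s : ℕ} (hs : s ≤ m) :
    vtx (List.replicate m a) s = s • stepVec a := by
  rw [vtx, List.take_replicate, min_eq_left hs, sum_replicate_stepVec]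

/-- The block of a letter advances the new column from `Φ_τ(x)` to `Φ_τ(x + e_a)`. [folklore] -/
theorem mult_mul_stepVec_zero (τ : ℤ → ℕ) (x : ℤ) (a : Fin 4) :
    (mult τ x a : ℤ) * stepVec a 0 = Phi τ (x + stepVec a 0) - Phi τ x := by
  fin_cases a
  · simp [Phi_succ]
  · have := Phi_succ τ (x - 1)
    rw [sub_add_cancel] at this
    simp only [Fin.mk_one, Fin.isValue, mult_W, stepVec_one, Pi.neg_apply, Pi.single_eq_same]
    rw [show x + -1 = x - 1 by ring]
    linarith
  · simp
  · simp

/-- **Endpoint formula, `x`-coordinate**: re-stretching moves the end column from `x + X(u)` to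
`Φ_τ(x + X(u))` (relative to `Φ_τ(x)`). [folklore] -/
theorem vtx_restretch_length_zero (τ : ℤ → ℕ) (x : ℤ) (u : List (Fin 4)) :
    vtx (restretch τ x u) (restretch τ x u).length 0 = Phi τ (x + vtx u u.length 0) - Phi τ x := by
  induction u generalizing x with
  | nil => simp
  | cons a u ih =>
    rw [restretch_cons, vtx_length, List.map_append, List.sum_append, sum_replicate_stepVec,
      Pi.add_apply, ← vtx_length, ih, List.length_cons, vtx_cons_succ, Pi.add_apply,
      Pi.smul_apply, nsmul_eq_mul, mult_mul_stepVec_zero, ← add_assoc]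
    ring

/-- **Endpoint formula, `y`-coordinate**: re-stretching does not change heights. [folklore] -/
theorem vtx_restretch_length_one (τ : ℤ → ℕ) (x : ℤ) (u : List (Fin 4)) :
    vtx (restretch τ x u) (restretch τ x u).length 1 = vtx u u.length 1 := by
  induction u generalizing x with
  | nil => simp
  | cons a u ih =>
    rw [restretch_cons, vtx_length, List.map_append, List.sum_append, sum_replicate_stepVec,
      Pi.add_apply, ← vtx_length, ih, List.length_cons, vtx_cons_succ, Pi.add_apply,
      Pi.smul_apply, nsmul_eq_mul]
    congr 1
    fin_cases a <;> simp

/-! ### Composition of re-stretchings -/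

/-- The composite width function: stretching by `τ` and then by `σ` (read in the new columns)
is stretching by `comp τ σ`, `(comp τ σ) g = Σ_{j < τ g} σ (Φ_τ g + j)`. [folklore] -/
def comp (τ σ : ℤ → ℕ) (g : ℤ) : ℕ := ∑ j ∈ Finset.range (τ g), σ (Phi τ g + j)

/-- Re-stretching a run of `E`'s. [folklore] -/
theorem restretch_replicate_E (σ : ℤ → ℕ) (y : ℤ) (m : ℕ) :
    restretch σ y (List.replicate m 0) =
      List.replicate (∑ j ∈ Finset.range m, σ (y + j)) 0 := by
  induction m generalizing y with
  | zero => simp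
  | succ m ih =>
    rw [List.replicate_succ, restretch_cons, ih, ← List.replicate_add, Finset.sum_range_succ',
      add_comm]
    congr 2
    · refine Finset.sum_congr rfl fun j _ => ?_
      congr 1
      simp only [stepVec_zero, Fin.isValue, Pi.single_eq_same, Nat.cast_add, Nat.cast_one]
      ring
    · simp

/-- Re-stretching a run of `W`'s. [folklore] -/
theorem restretch_replicate_W (σ : ℤ → ℕ) (y : ℤ) (m : ℕ) :
    restretch σ y (List.replicate m 1) =
      List.replicate (∑ j ∈ Finset.range m, σ (y - 1 - j)) 1 := by
  induction m generalizing y with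
  | zero => simp
  | succ m ih =>
    rw [List.replicate_succ, restretch_cons, ih, ← List.replicate_add, Finset.sum_range_succ',
      add_comm]
    congr 2
    · refine Finset.sum_congr rfl fun j _ => ?_
      congr 1
      simp only [stepVec_one, Fin.isValue, Pi.neg_apply, Pi.single_eq_same, Nat.cast_add,
        Nat.cast_one]
      ring
    · simp

/-- Re-stretching one block. [folklore] -/
theorem restretch_replicate_mult (τ σ : ℤ → ℕ) (x : ℤ) (a : Fin 4) :
    restretch σ (Phi τ x) (List.replicate (mult τ x a) a) =
      List.replicate (mult (comp τ σ) x a) a := by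
  fin_cases a
  · simp only [Fin.zero_eta, Fin.isValue, mult_E]
    rw [restretch_replicate_E]
    rfl
  · simp only [Fin.mk_one, Fin.isValue, mult_W]
    rw [restretch_replicate_W, comp]
    congr 1
    have hP : Phi τ x = Phi τ (x - 1) + τ (x - 1) := by
      rw [← Phi_succ, sub_add_cancel]
    rw [hP, ← Finset.sum_range_reflect]
    refine Finset.sum_congr rfl fun j hj => ?_
    rw [Finset.mem_range] at hj
    congr 1
    push_cast [Nat.cast_sub (show j ≤ τ (x - 1) - 1 by omega),
      Nat.cast_sub (show 1 ≤ τ (x - 1) by omega)]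
    ring
  · simp
  · simp

/-- **Composition law**: `restretch σ (Φ_τ x) ∘ restretch τ x = restretch (comp τ σ) x`.
[folklore] -/
theorem restretch_restretch (τ σ : ℤ → ℕ) (x : ℤ) (u : List (Fin 4)) :
    restretch σ (Phi τ x) (restretch τ x u) = restretch (comp τ σ) x u := by
  induction u generalizing x with
  | nil => simp
  | cons a u ih =>
    rw [restretch_cons, restretch_append, restretch_replicate_mult, restretch_cons, ← ih]
    congr 2
    rw [vtx_length, sum_replicate_stepVec, Pi.smul_apply, nsmul_eq_mul, mult_mul_stepVec_zero]
    ring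

/-! ### Dependence on the widths of the crossed gaps only -/

/-- Two width functions agreeing on the gaps actually crossed give the same re-stretching.
[folklore] -/
theorem restretch_congr {τ τ' : ℤ → ℕ} {x : ℤ} {u : List (Fin 4)}
    (h : ∀ i < u.length, (u.getD i 0).val < 2 →
      τ (gapOf (x + vtx u i 0) (u.getD i 0)) = τ' (gapOf (x + vtx u i 0) (u.getD i 0))) :
    restretch τ x u = restretch τ' x u := by
  induction u generalizing x with
  | nil => rfl
  | cons a u ih =>
    rw [restretch_cons, restretch_cons]
    congr 1
    · congr 1
      unfold mult
      split_ifs with ha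
      · have := h 0 (by simp) (by simpa using ha)
        simpa using this
      · rfl
    · apply ih
      intro i hi hh
      have := h (i + 1) (by simpa using hi) (by simpa using hh)
      simpa [vtx_cons_succ, add_assoc] using this

/-- Unit widths change nothing. [folklore] -/
theorem restretch_one (x : ℤ) (u : List (Fin 4)) : restretch (fun _ => 1) x u = u := by
  induction u generalizing x with
  | nil => rfl
  | cons a u ih => rw [restretch_cons, mult_one, ih, List.replicate_one, List.singleton_append]

/-- A width function equal to one on every crossed gap changes nothing. [folklore] -/
theorem restretch_eq_self {τ : ℤ → ℕ} {x : ℤ} {u : List (Fin 4)}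
    (h : ∀ i < u.length, (u.getD i 0).val < 2 → τ (gapOf (x + vtx u i 0) (u.getD i 0)) = 1) :
    restretch τ x u = u := by
  rw [restretch_congr (τ' := fun _ => 1) h, restretch_one]

/-! ### Counting letters -/

/-- The number of vertical letters (`N` or `S`) of a step word. [folklore] -/
def vcount (w : List (Fin 4)) : ℕ :=
  w.countP fun a => decide (2 ≤ a.val)

/-- Horizontal and vertical letters exhaust the word. [folklore] -/
theorem hcount_add_vcount (w : List (Fin 4)) : hcount w + vcount w = w.length := by
  rw [hcount, vcount, List.length_eq_countP_add_countP (fun a => decide (a.val < 2))]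
  congr 2
  funext a
  fin_cases a <;> simp

/-- `vcount` is additive under concatenation. [folklore] -/
theorem vcount_append (u v : List (Fin 4)) : vcount (u ++ v) = vcount u + vcount v := by
  simp [vcount, List.countP_append]

/-- Re-stretching keeps the vertical letters. [folklore] -/
theorem vcount_restretch (τ : ℤ → ℕ) (x : ℤ) (u : List (Fin 4)) :
    vcount (restretch τ x u) = vcount u := by
  induction u generalizing x with
  | nil => rfl
  | cons a u ih =>
    rw [restretch_cons, vcount_append, ih, ← List.singleton_append (l := u), vcount_append]
    congr 1
    fin_cases a <;> simp [vcount, List.countP_replicate]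

/-- The number of horizontal letters after re-stretching: each horizontal letter contributes the
width of its gap. [folklore] -/
theorem hcount_restretch (τ : ℤ → ℕ) (x : ℤ) (u : List (Fin 4)) :
    hcount (restretch τ x u) = ∑ i ∈ Finset.range u.length,
      if (u.getD i 0).val < 2 then τ (gapOf (x + vtx u i 0) (u.getD i 0)) else 0 := by
  induction u generalizing x with
  | nil => rfl
  | cons a u ih =>
    rw [restretch_cons, hcount_append, ih, List.length_cons, Finset.sum_range_succ', add_comm]
    congr 1
    · refine Finset.sum_congr rfl fun i _ => ?_
      simp only [List.getD_cons_succ, vtx_cons_succ, Pi.add_apply, add_assoc]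
    · simp only [List.getD_cons_zero, vtx_zero, Pi.zero_apply, add_zero, hcount,
        List.countP_replicate, mult]
      by_cases ha : a.val < 2
      · simp [ha]
      · simp [ha]

/-- The length after re-stretching is the sum of the multiplicities. [folklore] -/
theorem length_restretch (τ : ℤ → ℕ) (x : ℤ) (u : List (Fin 4)) :
    (restretch τ x u).length = ∑ i ∈ Finset.range u.length, mult τ (x + vtx u i 0) (u.getD i 0) := by
  induction u generalizing x with
  | nil => rfl
  | cons a u ih =>
    rw [restretch_cons, List.length_append, List.length_replicate, ih, List.length_cons,
      Finset.sum_range_succ', add_comm]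
    congr 1
    · refine Finset.sum_congr rfl fun i _ => ?_
      simp only [List.getD_cons_succ, vtx_cons_succ, Pi.add_apply, add_assoc]
    · simp

/-! ### Injectivity for positive widths -/

/-- With positive widths, a word is determined by its re-stretching. [folklore] -/
theorem restretch_injective {τ : ℤ → ℕ} (h : ∀ g, 1 ≤ τ g) {x : ℤ} {u v : List (Fin 4)}
    (he : restretch τ x u = restretch τ x v) : u = v := by
  induction u generalizing x v with
  | nil =>
    cases v with
    | nil => rfl
    | cons b v =>
      exfalso
      have hl := congrArg List.length he
      simp only [restretch_nil, List.length_nil, restretch_cons, List.length_append,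
        List.length_replicate] at hl
      have := one_le_mult h x b
      omega
  | cons a u ih =>
    cases v with
    | nil =>
      exfalso
      have hl := congrArg List.length he
      simp only [restretch_nil, List.length_nil, restretch_cons, List.length_append,
        List.length_replicate] at hl
      have := one_le_mult h x a
      omega
    | cons b v =>
      rw [restretch_cons, restretch_cons] at he
      obtain ⟨k, hk⟩ : ∃ k, mult τ x a = k + 1 :=
        Nat.exists_eq_add_one_of_ne_zero (by have := one_le_mult h x a; omega)
      obtain ⟨k', hk'⟩ : ∃ k', mult τ x b = k' + 1 :=
        Nat.exists_eq_add_one_of_ne_zero (by have := one_le_mult h x b; omega)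
      rw [hk, hk', List.replicate_succ, List.replicate_succ, List.cons_append,
        List.cons_append, List.cons_eq_cons] at he
      obtain ⟨rfl, he⟩ := he
      rw [hk] at hk'
      obtain rfl : k = k' := by omega
      rw [ih (List.append_cancel_left he)]

/-! ### Vertices of the re-stretched word: blocks -/

/-- One more letter read: the re-stretching of a prefix grows by one block. [folklore] -/
theorem restretch_take_succ (τ : ℤ → ℕ) (x : ℤ) (u : List (Fin 4)) {i : ℕ} (hi : i < u.length) :
    restretch τ x (u.take (i + 1)) =
      restretch τ x (u.take i) ++ List.replicate (mult τ (x + vtx u i 0) u[i]) u[i] := by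
  rw [← List.take_concat_get' u i hi, restretch_append, restretch_cons, restretch_nil,
    List.append_nil, List.length_take, min_eq_left hi.le, vtx_take _ le_rfl]

/-- The start of block `i` (the image of the `i`-th vertex), `x`-coordinate. [folklore] -/
theorem vtx_restretch_take_zero (τ : ℤ → ℕ) (x : ℤ) (u : List (Fin 4)) {i : ℕ}
    (hi : i ≤ u.length) : vtx (restretch τ x (u.take i)) (restretch τ x (u.take i)).length 0 =
      Phi τ (x + vtx u i 0) - Phi τ x := by
  rw [vtx_restretch_length_zero, List.length_take, min_eq_left hi, vtx_take _ le_rfl]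

/-- The start of block `i`, `y`-coordinate. [folklore] -/
theorem vtx_restretch_take_one (τ : ℤ → ℕ) (x : ℤ) (u : List (Fin 4)) {i : ℕ}
    (hi : i ≤ u.length) :
    vtx (restretch τ x (u.take i)) (restretch τ x (u.take i)).length 1 = vtx u i 1 := by
  rw [vtx_restretch_length_one, List.length_take, min_eq_left hi, vtx_take _ le_rfl]

/-- **Vertex formula**: the `s`-th vertex inside block `i` of the re-stretched word is the block
start plus `s` steps `e_{u_i}`. [folklore] -/
theorem vtx_restretch (τ : ℤ → ℕ) (x : ℤ) (u : List (Fin 4)) {i s : ℕ} (hi : i < u.length)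
    (hs : s ≤ mult τ (x + vtx u i 0) u[i]) :
    vtx (restretch τ x u) ((restretch τ x (u.take i)).length + s) =
      vtx (restretch τ x (u.take i)) (restretch τ x (u.take i)).length + s • stepVec u[i] := by
  have hu : restretch τ x u = restretch τ x (u.take i) ++
      (List.replicate (mult τ (x + vtx u i 0) u[i]) u[i] ++
        restretch τ (x + vtx u i 0 + stepVec u[i] 0) (u.drop (i + 1))) := by
    conv_lhs => rw [← List.take_append_drop i u]
    rw [restretch_append, List.drop_eq_getElem_cons hi, restretch_cons, List.length_take,
      min_eq_left hi.le, vtx_take _ le_rfl]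
  rw [hu, vtx_append_add, ← vtx_length, vtx_append_left _ _ (by simpa using hs),
    vtx_replicate _ _ hs]

/-- Block lengths add up: the start of block `i+1`. [folklore] -/
theorem length_restretch_take_succ (τ : ℤ → ℕ) (x : ℤ) (u : List (Fin 4)) {i : ℕ}
    (hi : i < u.length) : (restretch τ x (u.take (i + 1))).length =
      (restretch τ x (u.take i)).length + mult τ (x + vtx u i 0) u[i] := by
  rw [restretch_take_succ τ x u hi, List.length_append, List.length_replicate]

/-- Block starts are monotone in the block index. [folklore] -/
theorem length_restretch_take_mono (τ : ℤ → ℕ) (x : ℤ) (u : List (Fin 4)) {i j : ℕ} (hij : i ≤ j) :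
    (restretch τ x (u.take i)).length ≤ (restretch τ x (u.take j)).length := by
  have : u.take j = u.take i ++ (u.take j).drop i := by
    conv_lhs => rw [← List.take_append_drop i (u.take j)]
    rw [List.take_take, min_eq_left hij]
  rw [this, restretch_append, List.length_append]
  omega

/-- The last block ends at the end. [folklore] -/
theorem length_restretch_take_length (τ : ℤ → ℕ) (x : ℤ) (u : List (Fin 4)) :
    (restretch τ x (u.take u.length)).length = (restretch τ x u).length := by
  rw [List.take_length]

/-- **Block decomposition**: every index of the re-stretched word lies in a unique block `i`, at
offset `s < mult`. Existence. [folklore] -/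
theorem exists_block (τ : ℤ → ℕ) (x : ℤ) (u : List (Fin 4)) {K : ℕ}
    (hK : K < (restretch τ x u).length) :
    ∃ i s, i < u.length ∧ s < mult τ (x + vtx u i 0) (u.getD i 0) ∧
      K = (restretch τ x (u.take i)).length + s := by
  induction u generalizing x K with
  | nil => simp at hK
  | cons a u ih =>
    rw [restretch_cons, List.length_append, List.length_replicate] at hK
    by_cases hlt : K < mult τ x a
    · exact ⟨0, K, by simp, by simpa using hlt, by simp⟩
    · obtain ⟨i, s, hi, hs, hK'⟩ := ih (x := x + stepVec a 0) (K := K - mult τ x a) (by omega)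
      refine ⟨i + 1, s, by simpa using hi, ?_, ?_⟩
      · simpa [vtx_cons_succ, add_assoc] using hs
      · rw [List.take_succ_cons, restretch_cons, List.length_append, List.length_replicate]
        omega

/-- **Block decomposition**, uniqueness. [folklore] -/
theorem block_unique (τ : ℤ → ℕ) (x : ℤ) (u : List (Fin 4)) {i i' s s' : ℕ} (hi : i < u.length)
    (hi' : i' < u.length) (hs : s < mult τ (x + vtx u i 0) u[i])
    (hs' : s' < mult τ (x + vtx u i' 0) u[i'])
    (h : (restretch τ x (u.take i)).length + s = (restretch τ x (u.take i')).length + s') :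
    i = i' ∧ s = s' := by
  rcases lt_trichotomy i i' with hlt | rfl | hgt
  · exfalso
    have h1 := length_restretch_take_succ τ x u hi
    have h2 := length_restretch_take_mono τ x u (show i + 1 ≤ i' by omega)
    omega
  · exact ⟨rfl, by omega⟩
  · exfalso
    have h1 := length_restretch_take_succ τ x u hi'
    have h2 := length_restretch_take_mono τ x u (show i' + 1 ≤ i by omega)
    omega

end Haruspicy

end Literature.Barriers.CriticalPhenomena
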